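import Summits.ABC.IUTFork.Cor312NaivePadicBalls
import HarnessLib

/-!
# [IUTchIII] Cor. 3.12 — the UNIT-INDETERMINACY test model, I: `p`-adic unit shells

Record-only file (D-0012; MODEL DATA, no `Prop` fact, nothing asserted about print) of the abc-iut cell (wave-4 prover
abc-iut-w4-d101, gen 4 — author lineage of the countermodel of record `Cor312Vol.PinnedWitness.pinned_countermodel`, p419720).
TAKES NO SIDE on [IUTchIII] Cor. 3.12. In the countermodel of record, over abc-iut-w4-d101's SIGN shells (`signShells`, p412586), "Ism"
and the strip-automorphisms are `{±1}`, so the whole group `⟨(Ind1) ∪ (Ind2)⟩` «acts by signs» (abc-iut-w5-d161's clause census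
2026-08-26T05:19:50Z, C6). Here the sign group is replaced by the **`p`-ADIC UNITS OF `ℚ`** `{c ∈ ℚ^× | v_p(c) = 0}` acting by
multiplication ([IUTchIII] Prop. 1.2 (vi) "Ism" ∋ the units acting by multiplication; on the carrier `ℚ` standing for `ℚ_p` an infinite
group, dense in `ℤ_p^×`, containing `{±1}`): `unitShells p`; `ActsByUnits` — every element of the NEW `⟨(Ind1) ∪ (Ind2)⟩` multiplies each
packet line by a unit (`actsByUnits_of_mem_closure`), hence fixes every `p`-adic ball (`image_uBall_of_mem_closure`; the balls `uBall`, frame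
`uFrame` and volume `uVol` are abc-iut-w5-d247's `pBall`/`pFrame`/`pVol`, p414946, on the same packets); two such elements commute
(`ActsByUnits.comm`); `uFam p c` — the (Ind2)-family «multiply by the unit `c` on every summand of every factor», `u₀ := 1 + p`.
Sequels: `Cor312UnitThm311` (distinct vertical lines, typed Thm. 3.11), `Cor312UnitCountermodel` (the pin-respecting countermodel).
Interface-level, over c312-7's one-place `toyIndex` (`l⋇ = 2`); not a model of initial Θ-data. [claim: Mochizuki2012, status: disputed]
-/

noncomputable section

namespace Summit.ABC.IUTFork.Cor312Vol.UnitWitness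

open Thm311 Cor312 Cor312.Checks Cor312.IdentifiedNonVacuity NaiveWitness Literature.IUT.LogThetaLattice

variable (p : ℕ)

/-! ## 1. The `p`-adic units of `ℚ` acting by multiplication -/

/-- `c` is a `p`-ADIC UNIT of `ℚ`: `c ≠ 0` and `v_p(c) = 0`. [folklore] -/
def IsPUnit (c : ℚ) : Prop := c ≠ 0 ∧ padicValRat p c = 0

/-- `1` is a unit. [folklore] -/
theorem isPUnit_one : IsPUnit p 1 := ⟨one_ne_zero, padicValRat.one⟩

/-- `−1` is a unit. [folklore] -/
theorem isPUnit_neg_one : IsPUnit p (-1) := ⟨by norm_num, by rw [padicValRat.neg]; exact padicValRat.one⟩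

variable {p}

/-- Units are closed under multiplication. [folklore] -/
theorem IsPUnit.mul [hp : Fact p.Prime] {c d : ℚ} (hc : IsPUnit p c) (hd : IsPUnit p d) : IsPUnit p (c * d) :=
  ⟨mul_ne_zero hc.1 hd.1, by rw [padicValRat.mul hc.1 hd.1, hc.2, hd.2, add_zero]⟩

/-- Units are closed under inversion. [folklore] -/
theorem IsPUnit.inv [hp : Fact p.Prime] {c : ℚ} (hc : IsPUnit p c) : IsPUnit p c⁻¹ :=
  ⟨inv_ne_zero hc.1, by rw [padicValRat.inv, hc.2, neg_zero]⟩

/-- Units are closed under integer powers. [folklore] -/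
theorem IsPUnit.zpow [hp : Fact p.Prime] {c : ℚ} (hc : IsPUnit p c) (n : ℤ) : IsPUnit p (c ^ n) :=
  ⟨zpow_ne_zero n hc.1, by rw [padicValRat.zpow, hc.2, mul_zero]⟩

/-- A finite product of units is a unit. [folklore] -/
theorem isPUnit_prod [hp : Fact p.Prime] {ι : Type} [Fintype ι] {s : ι → ℚ} (hs : ∀ i, IsPUnit p (s i)) :
    IsPUnit p (∏ i, s i) :=
  Finset.prod_induction s (IsPUnit p) (fun _ _ ha hb => ha.mul hb) (isPUnit_one p) fun i _ => hs i

/-- Multiplication by a unit does not change vanishing or `v_p`. [folklore] -/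
theorem unit_mul_mem_iff [hp : Fact p.Prime] {c : ℚ} (hc : IsPUnit p c) (k : ℤ) (x : ℚ) :
    (c * x = 0 ∨ k ≤ padicValRat p (c * x)) ↔ (x = 0 ∨ k ≤ padicValRat p x) := by
  by_cases hx : x = 0
  · subst hx; simp
  · rw [padicValRat.mul hc.1 hx, hc.2, zero_add]
    exact or_congr_left (by simp [hc.1, hx])

variable (p)

/-- MULTIPLICATION BY `c ≠ 0` as a linear automorphism of `ℚ`. [folklore] -/
def mulEquiv (c : ℚ) (hc : c ≠ 0) : ℚ ≃ₗ[ℚ] ℚ where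
  toFun y := c * y
  invFun y := c⁻¹ * y
  map_add' := mul_add c
  map_smul' r y := by simp only [smul_eq_mul, RingHom.id_apply]; ring
  left_inv y := by simp only; rw [← mul_assoc, inv_mul_cancel₀ hc, one_mul]
  right_inv y := by simp only; rw [← mul_assoc, mul_inv_cancel₀ hc, one_mul]

/-- `mulEquiv c y = c * y`. [folklore] -/
@[simp] theorem mulEquiv_apply (c : ℚ) (hc : c ≠ 0) (y : ℚ) : mulEquiv c hc y = c * y := rfl

/-- The `p`-ADIC UNITS acting on `ℚ` by multiplication — the "Ism" and the strip-automorphism group of the unit shells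
([IUTchIII] Prop. 1.2 (vi); module docstring). [claim: Mochizuki2012, status: disputed] -/
def padicUnits : Set (ℚ ≃ₗ[ℚ] ℚ) := {g | ∃ c : ℚ, IsPUnit p c ∧ ∀ y : ℚ, g y = c * y}

/-- The identity is a unit multiplication. [folklore] -/
theorem refl_mem_padicUnits : LinearEquiv.refl ℚ ℚ ∈ padicUnits p := ⟨1, isPUnit_one p, fun y => (one_mul y).symm⟩

/-- `mulEquiv c ∈ padicUnits` for a unit `c`. [folklore] -/
theorem mulEquiv_mem_padicUnits {c : ℚ} (hc : IsPUnit p c) : mulEquiv c hc.1 ∈ padicUnits p := ⟨c, hc, fun _ => rfl⟩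

/-- The sign group `{±1}` of the sign shells is CONTAINED in the unit group (the new indeterminacies extend the old). [folklore] -/
theorem signs_subset_padicUnits : signs ⊆ padicUnits p := by
  rintro g (rfl | rfl)
  · exact refl_mem_padicUnits p
  · exact ⟨-1, isPUnit_neg_one p, fun y => by simp [LinearEquiv.neg_apply]⟩

/-! ## 2. The unit shells -/

/-- **The UNIT SHELLS**: `log(D⊢_v) := ℚ`, log-shell the `p`-adic unit ball `{v_p ≥ 0}`, strip-automorphisms and "Ism" both the
`p`-adic units acting by multiplication (an `abbrev`, so that the carrier reduces to `ℚ`). [claim: Mochizuki2012, status: disputed] -/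
abbrev unitShells : LogShells toyIndex where
  carrier := fun _ => ℚ
  shell := fun _ => {x | x = 0 ∨ 0 ≤ padicValRat p x}
  stripAut := fun _ => padicUnits p
  ism := fun _ => padicUnits p
  one_mem_stripAut := fun _ => refl_mem_padicUnits p
  one_mem_ism := fun _ => refl_mem_padicUnits p

/-! ## 3. Acting by units -/

/-- A packet-automorphism family ACTS BY UNITS: on every packet line it is multiplication by a `p`-adic unit. [folklore] -/
structure ActsByUnits (Φ : (unitShells p).PacketAut) : Prop where
  /-- on every packet line `Φ` is multiplication by a unit -/
  unit : ∀ (j : toyIndex.Label) (vQ : toyIndex.VQ), ∃ c : ℚ, IsPUnit p c ∧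
    ∀ x : (unitShells p).Packet j vQ, line j vQ (Φ j vQ x) = c * line j vQ x

variable {p}

/-- A family of abc-iut-w4-d101's sign shells acting by signs acts by units. [folklore] -/
theorem actsByUnits_of_actsBySigns {Φ : signShells.PacketAut} (h : ActsBySigns Φ) : ActsByUnits p Φ := by
  refine ⟨fun j vQ => ?_⟩
  obtain ⟨ε, hε, hΦ⟩ := h.sign j vQ
  rcases (abs_eq (zero_le_one' ℚ)).1 hε with rfl | rfl
  · exact ⟨1, isPUnit_one p, hΦ⟩
  · exact ⟨-1, isPUnit_neg_one p, hΦ⟩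

/-- A summand-wise unit automorphism of the 1-packet `Fibre → ℚ` (one-point fibre) is a unit multiple. [folklore] -/
theorem summandwise_eq_smul (vQ : toyIndex.VQ)
    (g : ∀ v : toyIndex.Fibre vQ, (unitShells p).carrier v.1 ≃ₗ[ℚ] (unitShells p).carrier v.1)
    (hg : ∀ v, g v ∈ padicUnits p) :
    ∃ c : ℚ, IsPUnit p c ∧ ∀ y : (unitShells p).Packet1 vQ, (unitShells p).summandwise vQ g y = c • y := by
  haveI := toyFibreUnique vQ
  obtain ⟨c, hc, hgc⟩ := hg default
  refine ⟨c, hc, fun y => ?_⟩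
  funext v
  rw [Unique.eq_default v]
  exact hgc _

/-- Two families acting by scalars on the packet lines COMMUTE pointwise (the packets are lines). [folklore] -/
theorem ActsByUnits.comm {Φ Ψ : (unitShells p).PacketAut} (hΦ : ActsByUnits p Φ) (hΨ : ActsByUnits p Ψ)
    (j : toyIndex.Label) (vQ : toyIndex.VQ) (x : (unitShells p).Packet j vQ) :
    Φ j vQ (Ψ j vQ x) = Ψ j vQ (Φ j vQ x) := by
  obtain ⟨c, -, hc⟩ := hΦ.unit j vQ
  obtain ⟨d, -, hd⟩ := hΨ.unit j vQ
  apply (line j vQ).injective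
  rw [hc, hd, hd, hc]
  ring

/-- … hence so do the induced automorphisms of the star-packets `∏_{j ∈ 𝔽_l^⋇}`. [folklore] -/
theorem ActsByUnits.starAut_comm {Φ Ψ : (unitShells p).PacketAut} (hΦ : ActsByUnits p Φ) (hΨ : ActsByUnits p Ψ)
    (v : toyIndex.V) (f : (unitShells p).StarPacket v) :
    (unitShells p).starAut Φ v ((unitShells p).starAut Ψ v f) =
      (unitShells p).starAut Ψ v ((unitShells p).starAut Φ v f) := by
  funext j
  exact hΦ.comm hΨ j.1 (toyIndex.over v) (f j)

/-- … and the images of any set of star-packet tuples under the two commute. [folklore] -/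
theorem ActsByUnits.image_starAut_comm {Φ Ψ : (unitShells p).PacketAut} (hΦ : ActsByUnits p Φ) (hΨ : ActsByUnits p Ψ)
    (v : toyIndex.V) (X : Set ((unitShells p).StarPacket v)) :
    (unitShells p).starAut Φ v '' ((unitShells p).starAut Ψ v '' X) =
      (unitShells p).starAut Ψ v '' ((unitShells p).starAut Φ v '' X) := by
  rw [Set.image_image, Set.image_image]
  exact Set.image_congr fun f _ => hΦ.starAut_comm hΨ v f


/-- The identity family acts by units. [folklore] -/
theorem actsByUnits_one : ActsByUnits p 1 := ⟨fun j vQ => ⟨1, isPUnit_one p, fun x => by rw [one_mul]; rfl⟩⟩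

section WithPrime

variable [hp : Fact p.Prime]

/-- Every (Ind2)-family of the unit shells (independent units on each summand of each factor) acts by units. [folklore] -/
theorem actsByUnits_of_mem_Ind2Family {Φ : (unitShells p).PacketAut} (h : Φ ∈ (unitShells p).Ind2Family) :
    ActsByUnits p Φ := by
  refine ⟨fun j vQ => ?_⟩
  obtain ⟨g, hg, hΦ⟩ := h j vQ
  have hs : ∀ i, ∃ c : ℚ, IsPUnit p c ∧
      ∀ y : (unitShells p).Packet1 vQ, (unitShells p).summandwise vQ (g i) y = c • y :=
    fun i => summandwise_eq_smul vQ (g i) (hg i)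
  choose s hs1 hs2 using hs
  refine ⟨∏ i, s i, isPUnit_prod hs1, fun x => ?_⟩
  rw [hΦ]
  exact line_factorwise_of_smul j vQ _ s hs2 x

/-- Every (Ind1)-family (a permutation of the capsule, unit strip-automorphisms on every summand of every factor) acts by units. [folklore] -/
theorem actsByUnits_of_mem_Ind1Family {Φ : (unitShells p).PacketAut} (h : Φ ∈ (unitShells p).Ind1Family) :
    ActsByUnits p Φ := by
  refine ⟨fun j vQ => ?_⟩
  obtain ⟨σ, hh, hmem, hΦ⟩ := h j
  have hs : ∀ i, ∃ c : ℚ, IsPUnit p c ∧ ∀ y : (unitShells p).Packet1 vQ,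
      (unitShells p).summandwise vQ (fun v => hh i v.1) y = c • y :=
    fun i => summandwise_eq_smul vQ (fun v => hh i v.1) fun v => hmem i v.1
  choose s hs1 hs2 using hs
  refine ⟨∏ i, s i, isPUnit_prod hs1, fun x => ?_⟩
  have hΦ' : Φ j vQ = ((unitShells p).permute j vQ σ).trans
      ((unitShells p).factorwise j vQ fun i => (unitShells p).summandwise vQ fun v => hh i v.1) := hΦ vQ
  rw [hΦ', LinearEquiv.trans_apply]
  have h1 : line j vQ (((unitShells p).factorwise j vQ fun i => (unitShells p).summandwise vQ fun v => hh i v.1)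
      (((unitShells p).permute j vQ σ) x)) = (∏ i, s i) * line j vQ (((unitShells p).permute j vQ σ) x) :=
    line_factorwise_of_smul j vQ _ s hs2 _
  have h2 : line j vQ (((unitShells p).permute j vQ σ) x) = line j vQ x := line_permute j vQ σ x
  rw [h1, h2]

/-- Acting by units is closed under composition. [folklore] -/
theorem ActsByUnits.mul {Φ Ψ : (unitShells p).PacketAut} (hΦ : ActsByUnits p Φ) (hΨ : ActsByUnits p Ψ) :
    ActsByUnits p (Φ * Ψ) := by
  refine ⟨fun j vQ => ?_⟩
  obtain ⟨c, hc, hΦc⟩ := hΦ.unit j vQ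
  obtain ⟨d, hd, hΨd⟩ := hΨ.unit j vQ
  refine ⟨c * d, hc.mul hd, fun x => ?_⟩
  show line j vQ (Φ j vQ (Ψ j vQ x)) = _
  rw [hΦc, hΨd, mul_assoc]

/-- Acting by units is closed under inverses. [folklore] -/
theorem ActsByUnits.inv {Φ : (unitShells p).PacketAut} (hΦ : ActsByUnits p Φ) : ActsByUnits p Φ⁻¹ := by
  refine ⟨fun j vQ => ?_⟩
  obtain ⟨c, hc, hΦc⟩ := hΦ.unit j vQ
  refine ⟨c⁻¹, hc.inv, fun x => ?_⟩
  show line j vQ ((Φ j vQ).symm x) = _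
  have h := hΦc ((Φ j vQ).symm x)
  rw [LinearEquiv.apply_symm_apply] at h
  rw [h, ← mul_assoc, inv_mul_cancel₀ hc.1, one_mul]

/-- **Every element of the group generated by (Ind1), (Ind2) acts by units** on the packet lines of the unit shells.
[folklore] -/
theorem actsByUnits_of_mem_closure {Φ : (unitShells p).PacketAut}
    (h : Φ ∈ Subgroup.closure ((unitShells p).Ind1Family ∪ (unitShells p).Ind2Family)) : ActsByUnits p Φ := by
  induction h using Subgroup.closure_induction with
  | mem Ψ hΨ =>
    rcases hΨ with h1 | h2
    · exact actsByUnits_of_mem_Ind1Family h1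
    · exact actsByUnits_of_mem_Ind2Family h2
  | one => exact actsByUnits_one
  | mul Ψ Ψ' _ _ hΨ hΨ' => exact hΨ.mul hΨ'
  | inv Ψ _ hΨ => exact hΨ.inv

end WithPrime

/-! ## 4. The `p`-adic balls as regions of the UNIT shells' packets; units fix every ball -/

variable (p)

/-- The `p`-ADIC BALL `B_k` as a region of a tensor packet of the UNIT shells — the same set as abc-iut-w5-d247's `pBall p j vQ k`
(same packet), re-typed so that statements over the unit shells are homogeneous. [claim: Mochizuki2012, status: disputed] -/
def uBall (j : toyIndex.Label) (vQ : toyIndex.VQ) (k : ℤ) : Set ((unitShells p).Packet j vQ) := pBall p j vQ k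

/-- The HULL FRAME of `p`-adic balls on a packet of the unit shells (abc-iut-w5-d247's `pFrame`, re-typed). [claim: Mochizuki2012, status: disputed] -/
def uFrame (j : toyIndex.Label) (vQ : toyIndex.VQ) : HullFrame ((unitShells p).Packet j vQ) := pFrame p j vQ

/-- The LOG-VOLUME `μ(B_k) = −k·log p` on a packet of the unit shells (abc-iut-w5-d247's `pVol`, re-typed). [claim: Mochizuki2012, status: disputed] -/
def uVol (j : toyIndex.Label) (vQ : toyIndex.VQ) (A : Set ((unitShells p).Packet j vQ)) : ℝ := pVol p j vQ A

/-- Membership in `B_k`: `line x = 0 ∨ v_p(line x) ≥ k`. [folklore] -/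
theorem mem_uBall_iff (j : toyIndex.Label) (vQ : toyIndex.VQ) (k : ℤ) (x : (unitShells p).Packet j vQ) :
    x ∈ uBall p j vQ k ↔ line j vQ x = 0 ∨ k ≤ padicValRat p (line j vQ x) := Iff.rfl

/-- `0 ∈ B_k`. [folklore] -/
theorem zero_mem_uBall (j : toyIndex.Label) (vQ : toyIndex.VQ) (k : ℤ) : (0 : (unitShells p).Packet j vQ) ∈ uBall p j vQ k :=
  zero_mem_pBall p j vQ k

/-- The balls are nested. [folklore] -/
theorem uBall_mono (j : toyIndex.Label) (vQ : toyIndex.VQ) {k k' : ℤ} (h : k' ≤ k) : uBall p j vQ k ⊆ uBall p j vQ k' :=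
  pBall_mono p j vQ h

/-- `k ↦ B_k` is injective. [folklore] -/
theorem uBall_injective [Fact p.Prime] (j : toyIndex.Label) (vQ : toyIndex.VQ) : Function.Injective (uBall p j vQ) := pBall_injective p j vQ

/-- Balls are hull-sets. [folklore] -/
theorem uBall_mem_hul (j : toyIndex.Label) (vQ : toyIndex.VQ) (k : ℤ) : uBall p j vQ k ∈ (uFrame p j vQ).Hul := ⟨k, rfl⟩

/-- The hull of a ball is itself. [folklore] -/
theorem uFrame_hull_uBall (j : toyIndex.Label) (vQ : toyIndex.VQ) (k : ℤ) : (uFrame p j vQ).hull (uBall p j vQ k) = uBall p j vQ k :=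
  pFrame_hull_pBall p j vQ k

/-- A ball is bounded and admits its hull. [folklore] -/
theorem uFrame_bounded_hasHull [Fact p.Prime] (j : toyIndex.Label) (vQ : toyIndex.VQ) (k : ℤ) :
    (uFrame p j vQ).IsBounded (uBall p j vQ k) ∧ (uFrame p j vQ).HasHull (uBall p j vQ k) :=
  pFrame_bounded_hasHull p j vQ k

/-- `μ(B_k) = −k·log p`. [folklore] -/
theorem uVol_uBall [Fact p.Prime] (j : toyIndex.Label) (vQ : toyIndex.VQ) (k : ℤ) : uVol p j vQ (uBall p j vQ k) = -(k : ℝ) * Real.log p :=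
  pVol_pBall p j vQ k

/-- The log-volume is monotone on balls. [folklore] -/
theorem uVol_mono [Fact p.Prime] {j : toyIndex.Label} {vQ : toyIndex.VQ} {k k' : ℤ} (h : uBall p j vQ k ⊆ uBall p j vQ k') :
    uVol p j vQ (uBall p j vQ k) ≤ uVol p j vQ (uBall p j vQ k') :=
  pVol_mono p h

variable {p}

/-- **A family acting by units FIXES every `p`-adic ball** (as a set — not pointwise). [folklore] -/
theorem image_uBall_of_actsByUnits [Fact p.Prime] {Φ : (unitShells p).PacketAut} (h : ActsByUnits p Φ) (j : toyIndex.Label)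
    (vQ : toyIndex.VQ) (k : ℤ) : Φ j vQ '' uBall p j vQ k = uBall p j vQ k := by
  obtain ⟨c, hc, hΦ⟩ := h.unit j vQ
  apply Set.Subset.antisymm
  · rintro _ ⟨x, hx, rfl⟩
    rw [mem_uBall_iff, hΦ, unit_mul_mem_iff hc k]
    exact hx
  · intro x hx
    refine ⟨(Φ j vQ).symm x, ?_, LinearEquiv.apply_symm_apply _ _⟩
    have h1 := hΦ ((Φ j vQ).symm x)
    rw [LinearEquiv.apply_symm_apply] at h1
    rw [mem_uBall_iff, ← unit_mul_mem_iff hc k, ← h1]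
    exact hx

/-- … and so does its inverse. [folklore] -/
theorem symm_image_uBall_of_actsByUnits [Fact p.Prime] {Φ : (unitShells p).PacketAut} (h : ActsByUnits p Φ) (j : toyIndex.Label)
    (vQ : toyIndex.VQ) (k : ℤ) : (Φ j vQ).symm '' uBall p j vQ k = uBall p j vQ k :=
  image_uBall_of_actsByUnits h.inv j vQ k

/-- A family acting by units maps a set onto a ball iff the set IS that ball. [folklore] -/
theorem image_eq_uBall_iff_of_actsByUnits [Fact p.Prime] {Φ : (unitShells p).PacketAut} (h : ActsByUnits p Φ) (j : toyIndex.Label)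
    (vQ : toyIndex.VQ) (A : Set ((unitShells p).Packet j vQ)) (k : ℤ) :
    Φ j vQ '' A = uBall p j vQ k ↔ A = uBall p j vQ k := by
  constructor
  · intro hA
    have := congrArg (fun B => (Φ j vQ).symm '' B) hA
    simp only [Set.image_image, LinearEquiv.symm_apply_apply, Set.image_id'] at this
    rw [this, symm_image_uBall_of_actsByUnits h]
  · rintro rfl; exact image_uBall_of_actsByUnits h j vQ k

/-- The same for the inverse family. [folklore] -/
theorem symm_image_eq_uBall_iff_of_actsByUnits [Fact p.Prime] {Φ : (unitShells p).PacketAut} (h : ActsByUnits p Φ) (j : toyIndex.Label)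
    (vQ : toyIndex.VQ) (A : Set ((unitShells p).Packet j vQ)) (k : ℤ) :
    (Φ j vQ).symm '' A = uBall p j vQ k ↔ A = uBall p j vQ k :=
  image_eq_uBall_iff_of_actsByUnits h.inv j vQ A k

/-- Every element of the group generated by (Ind1), (Ind2) fixes every ball. [folklore] -/
theorem image_uBall_of_mem_closure [Fact p.Prime] {Φ : (unitShells p).PacketAut}
    (h : Φ ∈ Subgroup.closure ((unitShells p).Ind1Family ∪ (unitShells p).Ind2Family)) (j : toyIndex.Label)
    (vQ : toyIndex.VQ) (k : ℤ) : Φ j vQ '' uBall p j vQ k = uBall p j vQ k :=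
  image_uBall_of_actsByUnits (actsByUnits_of_mem_closure h) j vQ k

/-! ## 5. The unit families `uFam c` and the size of the indeterminacy group -/

variable (p)

/-- **The (Ind2)-family «multiply by `c` on every summand of every factor»** (`c ≠ 0`). [claim: Mochizuki2012, status: disputed] -/
def uFam (c : ℚ) (hc : c ≠ 0) : (unitShells p).PacketAut := fun j vQ =>
  (unitShells p).factorwise j vQ fun _ => (unitShells p).summandwise vQ fun _ => mulEquiv c hc

/-- For a unit `c`, `uFam c` is an (Ind2)-family of the unit shells. [folklore] -/
theorem uFam_mem_Ind2Family {c : ℚ} (hc : IsPUnit p c) : uFam p c hc.1 ∈ (unitShells p).Ind2Family := fun _ _ =>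
  ⟨fun _ _ => mulEquiv c hc.1, fun _ _ => mulEquiv_mem_padicUnits p hc, rfl⟩

/-- … hence an element of `⟨(Ind1) ∪ (Ind2)⟩`. [folklore] -/
theorem uFam_mem_closure {c : ℚ} (hc : IsPUnit p c) :
    uFam p c hc.1 ∈ Subgroup.closure ((unitShells p).Ind1Family ∪ (unitShells p).Ind2Family) :=
  Subgroup.subset_closure (Or.inr (uFam_mem_Ind2Family p hc))

/-- `uFam c` is the scalar `c^{#S^±_{j+1}} = c^{j+1}` on the packet at label `j` (multilinearity). [folklore] -/
theorem line_uFam (c : ℚ) (hc : c ≠ 0) (j : toyIndex.Label) (vQ : toyIndex.VQ) (x : (unitShells p).Packet j vQ) :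
    line j vQ (uFam p c hc j vQ x) = c ^ ((j : ℕ) + 1) * line j vQ x := by
  have h := line_factorwise_of_smul j vQ (fun _ => (unitShells p).summandwise vQ fun _ => mulEquiv c hc) (fun _ => c)
    (fun _ y => by funext v; rfl) x
  rw [Finset.prod_const, Finset.card_univ, Fintype.card_fin] at h
  exact h

/-- `uFam c` acts by units (for a unit `c`). [folklore] -/
theorem uFam_actsByUnits [Fact p.Prime] {c : ℚ} (hc : IsPUnit p c) : ActsByUnits p (uFam p c hc.1) :=
  actsByUnits_of_mem_Ind2Family (uFam_mem_Ind2Family p hc)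

/-- The distinguished unit `u₀ := 1 + p` (`v_p(1 + p) = 0`, `1 + p ∉ {±1}`). [folklore] -/
def u₀ : ℚ := 1 + p

/-- `u₀ = 1 + p > 1`. [folklore] -/
theorem one_lt_u₀ [hp : Fact p.Prime] : 1 < u₀ p := by
  unfold u₀
  have : (0 : ℚ) < p := by exact_mod_cast hp.out.pos
  linarith

/-- `u₀` is a `p`-adic unit. [folklore] -/
theorem u₀_isPUnit [hp : Fact p.Prime] : IsPUnit p (u₀ p) := by
  refine ⟨(zero_lt_one.trans (one_lt_u₀ p)).ne', ?_⟩
  have h : u₀ p = ((1 + p : ℕ) : ℚ) := by unfold u₀; push_cast; ring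
  rw [h, ← padicValRat_of_nat, Nat.cast_eq_zero]
  refine padicValNat.eq_zero_of_not_dvd fun hd => ?_
  have h1 : p ∣ 1 := (Nat.dvd_add_right (dvd_refl p)).1 (by rwa [add_comm] at hd)
  exact hp.out.one_lt.ne' (Nat.dvd_one.1 h1)

/-- The powers `u₀^n`, `n ∈ ℤ`, are units. [folklore] -/
theorem u₀_zpow_isPUnit [Fact p.Prime] (n : ℤ) : IsPUnit p (u₀ p ^ n) := (u₀_isPUnit p).zpow n

/-- `n ↦ u₀^n` is injective. [folklore] -/
theorem u₀_zpow_injective [Fact p.Prime] : Function.Injective fun n : ℤ => u₀ p ^ n :=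
  zpow_right_injective₀ (zero_lt_one.trans (one_lt_u₀ p)) (one_lt_u₀ p).ne'

end Summit.ABC.IUTFork.Cor312Vol.UnitWitness

end
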